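import Summits.HubbardSuperconductivity.HubbardSuperconductivity.Theorems.AnisotropyChordStiffnessCurrentElements
import Summits.HubbardSuperconductivity.HubbardSuperconductivity.Theorems.AnisotropyChordStiffnessGroundStateTransform

/-!
# Route `AnisotropyChord` / H0 rotor rung: the PER-BOND SQUARE behind the diamagnetic grid bound (S5)(c)
# (theory seat memo ROTOR-THEORY-8 §109; the prover seat's exact sum-of-squares replacement of the Kato–Simon
# argument, valid for COMPLEX bond fields)

Fix a bond `(x, y)`, `x ≠ y`, of the torus, a real non-negative `ψ`, a complex `u` with `φ = u·ψ`, and a complex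
bond amplitude `A`.  With `σ' = σ∘swap_{xy}` and the flippable configurations `σ_x ≠ σ_y`:

* `bondCurrentForm_eq` — `⟨φ, j_{xy} ψ⟩ = Σ_σ c_σ conj(u σ) ψ(σ)ψ(σ')`, `c_σ = ±½` by orientation
  (`star_dotProduct_bondCurrent_mulVec`), and its SYMMETRISED form `bondCurrentForm_symm`:
  `= ½ Σ_σ c_σ (conj u(σ) − conj u(σ')) ψψ'` (the bond involution flips the orientation);
* `kineticBondForm_eq` — `Re⟨ψ, (SˣSˣ+SʸSʸ)_{xy} ψ⟩ = ½ Σ_{σ flippable} ψ(σ)ψ(σ')`;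
* **`bond_square_nonneg`** — `0 ≤ ¼Σ_{flip} ψψ'|u−u'|² − 2Re(−i A ⟨φ, j_{xy}ψ⟩) + ½|A|² Re⟨ψ, K_{xy}ψ⟩`:
  termwise this is `¼ ψψ' |u(σ) − u(σ') ± iA|² ≥ 0`.
-/

set_option linter.dupNamespace false

noncomputable section

open Matrix Complex Finset
open scoped ComplexConjugate
open Literature.MathematicalPhysics.QuantumLattice hiding torusPhase torusNorm
open Literature.Probability.LatticeModels

namespace Summit.HubbardSuperconductivity.HubbardSuperconductivity.Theorems.AnisotropyChord.Stiffness

variable {L : ℕ} [NeZero L]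

omit [NeZero L] in
/-- The orientation coefficient of a configuration across the bond `(x,y)`: `½` if `(σ_x,σ_y) = (0,1)`, `−½` if
`(1,0)`, `0` if not flippable; written inline below as nested `if`s.  It flips sign under the swap. [folklore] -/
theorem orient_comp_swap {x y : TorusSite 2 L} (σ : TensorIndex (TorusSite 2 L) 2) :
    (if (σ ∘ Equiv.swap x y) x = 0 ∧ (σ ∘ Equiv.swap x y) y = 1 then (1 / 2 : ℂ)
      else if (σ ∘ Equiv.swap x y) x = 1 ∧ (σ ∘ Equiv.swap x y) y = 0 then -(1 / 2 : ℂ) else 0)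
      = -(if σ x = 0 ∧ σ y = 1 then (1 / 2 : ℂ) else if σ x = 1 ∧ σ y = 0 then -(1 / 2 : ℂ) else 0) := by
  simp only [Function.comp_apply, Equiv.swap_apply_left, Equiv.swap_apply_right]
  have fin2 : ∀ t : Fin 2, t = 0 ∨ t = 1 := by decide
  rcases fin2 (σ x) with hx | hx <;> rcases fin2 (σ y) with hy | hy <;> simp [hx, hy]

/-- **The current form in `u`-coordinates:** for `φ = u·ψ` (`ψ` real),
`⟨φ, j_{xy}ψ⟩ = Σ_σ c_σ conj(u σ) ψ(σ) ψ(σ∘swap)`. [folklore] -/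
theorem bondCurrentForm_eq {x y : TorusSite 2 L} (hxy : x ≠ y) (ψ : TensorIndex (TorusSite 2 L) 2 → ℝ)
    (u φ : TensorIndex (TorusSite 2 L) 2 → ℂ) (hφ : ∀ σ, φ σ = u σ * (ψ σ : ℂ)) :
    star φ ⬝ᵥ (bondCurrent L x y *ᵥ fun σ => (ψ σ : ℂ))
      = ∑ σ, (if σ x = 0 ∧ σ y = 1 then (1 / 2 : ℂ) else if σ x = 1 ∧ σ y = 0 then -(1 / 2 : ℂ) else 0)
          * conj (u σ) * (ψ σ : ℂ) * (ψ (σ ∘ Equiv.swap x y) : ℂ) := by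
  rw [star_dotProduct_bondCurrent_mulVec hxy]
  refine Finset.sum_congr rfl fun σ _ => ?_
  rw [hφ σ, map_mul, Complex.conj_ofReal]
  split_ifs <;> ring

/-- **Symmetrised current form:** `⟨φ, j_{xy}ψ⟩ = ½ Σ_σ c_σ (conj u(σ) − conj u(σ∘swap)) ψψ'`. [folklore] -/
theorem bondCurrentForm_symm {x y : TorusSite 2 L} (hxy : x ≠ y) (ψ : TensorIndex (TorusSite 2 L) 2 → ℝ)
    (u φ : TensorIndex (TorusSite 2 L) 2 → ℂ) (hφ : ∀ σ, φ σ = u σ * (ψ σ : ℂ)) :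
    star φ ⬝ᵥ (bondCurrent L x y *ᵥ fun σ => (ψ σ : ℂ))
      = (1 / 2 : ℂ) * ∑ σ, (if σ x = 0 ∧ σ y = 1 then (1 / 2 : ℂ)
            else if σ x = 1 ∧ σ y = 0 then -(1 / 2 : ℂ) else 0)
          * (conj (u σ) - conj (u (σ ∘ Equiv.swap x y))) * (ψ σ : ℂ) * (ψ (σ ∘ Equiv.swap x y) : ℂ) := by
  rw [bondCurrentForm_eq hxy ψ u φ hφ]
  -- the reflected form
  have hrefl : ∑ σ : TensorIndex (TorusSite 2 L) 2,
      (if σ x = 0 ∧ σ y = 1 then (1 / 2 : ℂ) else if σ x = 1 ∧ σ y = 0 then -(1 / 2 : ℂ) else 0)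
        * conj (u σ) * (ψ σ : ℂ) * (ψ (σ ∘ Equiv.swap x y) : ℂ)
      = ∑ σ : TensorIndex (TorusSite 2 L) 2,
      -((if σ x = 0 ∧ σ y = 1 then (1 / 2 : ℂ) else if σ x = 1 ∧ σ y = 0 then -(1 / 2 : ℂ) else 0)
        * conj (u (σ ∘ Equiv.swap x y)) * (ψ σ : ℂ) * (ψ (σ ∘ Equiv.swap x y) : ℂ)) := by
    rw [← sum_comp_swap_symm x y (fun a b =>
      (if a x = 0 ∧ a y = 1 then (1 / 2 : ℂ) else if a x = 1 ∧ a y = 0 then -(1 / 2 : ℂ) else 0)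
        * conj (u a) * (ψ a : ℂ) * (ψ b : ℂ))]
    refine Finset.sum_congr rfl fun σ _ => ?_
    rw [orient_comp_swap σ]
    ring
  have h2 : (2 : ℂ) * ∑ σ : TensorIndex (TorusSite 2 L) 2,
      (if σ x = 0 ∧ σ y = 1 then (1 / 2 : ℂ) else if σ x = 1 ∧ σ y = 0 then -(1 / 2 : ℂ) else 0)
        * conj (u σ) * (ψ σ : ℂ) * (ψ (σ ∘ Equiv.swap x y) : ℂ)
      = ∑ σ : TensorIndex (TorusSite 2 L) 2,
      (if σ x = 0 ∧ σ y = 1 then (1 / 2 : ℂ) else if σ x = 1 ∧ σ y = 0 then -(1 / 2 : ℂ) else 0)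
          * (conj (u σ) - conj (u (σ ∘ Equiv.swap x y))) * (ψ σ : ℂ) * (ψ (σ ∘ Equiv.swap x y) : ℂ) := by
    rw [two_mul]
    nth_rw 2 [hrefl]
    rw [← Finset.sum_add_distrib]
    refine Finset.sum_congr rfl fun σ _ => by ring
  rw [← h2]; ring

/-- **The kinetic form:** `Re⟨ψ, (SˣSˣ+SʸSʸ)_{xy} ψ⟩ = ½ Σ_{σ flippable} ψ(σ)ψ(σ∘swap)` for real `ψ`. [folklore] -/
theorem kineticBondForm_eq {x y : TorusSite 2 L} (hxy : x ≠ y) (ψ : TensorIndex (TorusSite 2 L) 2 → ℝ) :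
    (star (fun σ => (ψ σ : ℂ)) ⬝ᵥ ((spinBond 1 0 x y + spinBond 1 1 x y : Op (TorusSite 2 L) 2) *ᵥ
        fun σ => (ψ σ : ℂ))).re
      = ∑ σ, (if σ x ≠ σ y then (1 / 2 : ℝ) * (ψ σ * ψ (σ ∘ Equiv.swap x y)) else 0) := by
  rw [star_dotProduct_kineticBond_mulVec hxy, Complex.re_sum]
  refine Finset.sum_congr rfl fun σ _ => ?_
  rw [Complex.conj_ofReal]
  split_ifs with h
  · have e : (ψ σ : ℂ) * ((1 / 2 : ℂ) * (ψ (σ ∘ Equiv.swap x y) : ℂ))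
        = (((1 / 2 : ℝ) * (ψ σ * ψ (σ ∘ Equiv.swap x y)) : ℝ) : ℂ) := by push_cast; ring
    rw [e, Complex.ofReal_re]
  · simp

/-- The elementary square: `0 ≤ ¼|z|² + ½ Re(i A s conj z) + ¼|A|²` for `s = ±1` (`= ¼|z + isA|²`). [folklore] -/
theorem quarter_square_nonneg (z A : ℂ) (s : ℝ) (hs : s = 1 ∨ s = -1) :
    0 ≤ (1 / 4 : ℝ) * ‖z‖ ^ 2 + (1 / 2 : ℝ) * (I * A * (s : ℂ) * conj z).re + (1 / 4 : ℝ) * ‖A‖ ^ 2 := by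
  have hs2 : s ^ 2 = 1 := by rcases hs with h | h <;> rw [h] <;> norm_num
  have key : (1 / 4 : ℝ) * ‖z‖ ^ 2 + (1 / 2 : ℝ) * (I * A * (s : ℂ) * conj z).re + (1 / 4 : ℝ) * ‖A‖ ^ 2
      = (1 / 4 : ℝ) * ‖z + I * (s : ℂ) * A‖ ^ 2 := by
    rw [← Complex.normSq_eq_norm_sq, ← Complex.normSq_eq_norm_sq, ← Complex.normSq_eq_norm_sq]
    simp only [Complex.normSq_apply, Complex.add_re, Complex.add_im, Complex.mul_re, Complex.mul_im,
      Complex.I_re, Complex.I_im, Complex.ofReal_re, Complex.ofReal_im, Complex.conj_re, Complex.conj_im]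
    nlinarith [hs2]
  rw [key]; positivity

/-- **THE PER-BOND SQUARE.**  For `x ≠ y`, real `ψ ≥ 0`, `φ = u·ψ` and a complex bond amplitude `A`:
`0 ≤ ¼ Σ_{flip} ψψ'|u − u'|² − 2 Re(−i A ⟨φ, j_{xy}ψ⟩) + ½|A|² Re⟨ψ, K_{xy}ψ⟩`
(termwise `¼ψψ'|u(σ) − u(σ') ± iA|²`). [folklore] -/
theorem bond_square_nonneg {x y : TorusSite 2 L} (hxy : x ≠ y) (ψ : TensorIndex (TorusSite 2 L) 2 → ℝ)
    (hψ : ∀ σ, 0 ≤ ψ σ) (u φ : TensorIndex (TorusSite 2 L) 2 → ℂ) (hφ : ∀ σ, φ σ = u σ * (ψ σ : ℂ)) (A : ℂ) :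
    0 ≤ (1 / 4 : ℝ) * ∑ σ, (if σ x ≠ σ y then
            ψ σ * ψ (σ ∘ Equiv.swap x y) * ‖u σ - u (σ ∘ Equiv.swap x y)‖ ^ 2 else 0)
        - 2 * (-I * A * (star φ ⬝ᵥ (bondCurrent L x y *ᵥ fun σ => (ψ σ : ℂ)))).re
        + (1 / 2 : ℝ) * ‖A‖ ^ 2 *
          (star (fun σ => (ψ σ : ℂ)) ⬝ᵥ ((spinBond 1 0 x y + spinBond 1 1 x y : Op (TorusSite 2 L) 2) *ᵥ
            fun σ => (ψ σ : ℂ))).re := by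
  rw [bondCurrentForm_symm hxy ψ u φ hφ, kineticBondForm_eq hxy ψ]
  -- everything as one configuration sum of real terms
  have hcur : (-I * A * ((1 / 2 : ℂ) * ∑ σ : TensorIndex (TorusSite 2 L) 2,
      (if σ x = 0 ∧ σ y = 1 then (1 / 2 : ℂ) else if σ x = 1 ∧ σ y = 0 then -(1 / 2 : ℂ) else 0)
        * (conj (u σ) - conj (u (σ ∘ Equiv.swap x y))) * (ψ σ : ℂ) * (ψ (σ ∘ Equiv.swap x y) : ℂ))).re
      = ∑ σ : TensorIndex (TorusSite 2 L) 2, (-I * A * (1 / 2 : ℂ) *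
        ((if σ x = 0 ∧ σ y = 1 then (1 / 2 : ℂ) else if σ x = 1 ∧ σ y = 0 then -(1 / 2 : ℂ) else 0)
        * (conj (u σ) - conj (u (σ ∘ Equiv.swap x y))) * (ψ σ : ℂ) * (ψ (σ ∘ Equiv.swap x y) : ℂ))).re := by
    rw [← mul_assoc, Finset.mul_sum, Complex.re_sum]
  rw [hcur, Finset.mul_sum, Finset.mul_sum, Finset.mul_sum, ← Finset.sum_sub_distrib, ← Finset.sum_add_distrib]
  refine Finset.sum_nonneg fun σ _ => ?_
  have hw : 0 ≤ ψ σ * ψ (σ ∘ Equiv.swap x y) := mul_nonneg (hψ σ) (hψ _)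
  have hconj : conj (u σ) - conj (u (σ ∘ Equiv.swap x y)) = conj (u σ - u (σ ∘ Equiv.swap x y)) := by
    rw [map_sub]
  have fin2 : ∀ t : Fin 2, t = 0 ∨ t = 1 := by decide
  rcases fin2 (σ x) with hx | hx <;> rcases fin2 (σ y) with hy | hy
  · simp [hx, hy]
  · -- orientation `(0,1)`: `ψψ' · ¼|z + iA|²`, `z = u − u'`
    have hflip : σ x ≠ σ y := by rw [hx, hy]; decide
    rw [if_pos hflip, if_pos hflip, if_pos ⟨hx, hy⟩, hconj]
    have hsq := quarter_square_nonneg (u σ - u (σ ∘ Equiv.swap x y)) A 1 (Or.inl rfl)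
    have e : (-I * A * (1 / 2 : ℂ) * ((1 / 2 : ℂ) * conj (u σ - u (σ ∘ Equiv.swap x y))
        * (ψ σ : ℂ) * (ψ (σ ∘ Equiv.swap x y) : ℂ))).re
        = -(1 / 4 : ℝ) * (ψ σ * ψ (σ ∘ Equiv.swap x y)) *
          (I * A * ((1 : ℝ) : ℂ) * conj (u σ - u (σ ∘ Equiv.swap x y))).re := by
      have : -I * A * (1 / 2 : ℂ) * ((1 / 2 : ℂ) * conj (u σ - u (σ ∘ Equiv.swap x y))
          * (ψ σ : ℂ) * (ψ (σ ∘ Equiv.swap x y) : ℂ))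
          = ((-(1 / 4 : ℝ) * (ψ σ * ψ (σ ∘ Equiv.swap x y)) : ℝ) : ℂ)
            * (I * A * ((1 : ℝ) : ℂ) * conj (u σ - u (σ ∘ Equiv.swap x y))) := by
        push_cast; ring
      rw [this, Complex.re_ofReal_mul]
    rw [e]
    have key : (1 / 4 : ℝ) * (ψ σ * ψ (σ ∘ Equiv.swap x y) * ‖u σ - u (σ ∘ Equiv.swap x y)‖ ^ 2)
        - 2 * (-(1 / 4 : ℝ) * (ψ σ * ψ (σ ∘ Equiv.swap x y)) *
          (I * A * ((1 : ℝ) : ℂ) * conj (u σ - u (σ ∘ Equiv.swap x y))).re)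
        + (1 / 2 : ℝ) * ‖A‖ ^ 2 * ((1 / 2 : ℝ) * (ψ σ * ψ (σ ∘ Equiv.swap x y)))
        = (ψ σ * ψ (σ ∘ Equiv.swap x y)) *
          ((1 / 4 : ℝ) * ‖u σ - u (σ ∘ Equiv.swap x y)‖ ^ 2
            + (1 / 2 : ℝ) * (I * A * ((1 : ℝ) : ℂ) * conj (u σ - u (σ ∘ Equiv.swap x y))).re
            + (1 / 4 : ℝ) * ‖A‖ ^ 2) := by ring
    rw [key]
    exact mul_nonneg hw hsq
  · -- orientation `(1,0)`: `ψψ' · ¼|z − iA|²`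
    have hflip : σ x ≠ σ y := by rw [hx, hy]; decide
    have hno : ¬ (σ x = 0 ∧ σ y = 1) := by rw [hx]; intro h; exact absurd h.1 (by decide)
    rw [if_pos hflip, if_pos hflip, if_neg hno, if_pos ⟨hx, hy⟩, hconj]
    have hsq := quarter_square_nonneg (u σ - u (σ ∘ Equiv.swap x y)) A (-1) (Or.inr rfl)
    have e : (-I * A * (1 / 2 : ℂ) * (-(1 / 2 : ℂ) * conj (u σ - u (σ ∘ Equiv.swap x y))
        * (ψ σ : ℂ) * (ψ (σ ∘ Equiv.swap x y) : ℂ))).re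
        = -(1 / 4 : ℝ) * (ψ σ * ψ (σ ∘ Equiv.swap x y)) *
          (I * A * ((-1 : ℝ) : ℂ) * conj (u σ - u (σ ∘ Equiv.swap x y))).re := by
      have : -I * A * (1 / 2 : ℂ) * (-(1 / 2 : ℂ) * conj (u σ - u (σ ∘ Equiv.swap x y))
          * (ψ σ : ℂ) * (ψ (σ ∘ Equiv.swap x y) : ℂ))
          = ((-(1 / 4 : ℝ) * (ψ σ * ψ (σ ∘ Equiv.swap x y)) : ℝ) : ℂ)
            * (I * A * ((-1 : ℝ) : ℂ) * conj (u σ - u (σ ∘ Equiv.swap x y))) := by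
        push_cast; ring
      rw [this, Complex.re_ofReal_mul]
    rw [e]
    have key : (1 / 4 : ℝ) * (ψ σ * ψ (σ ∘ Equiv.swap x y) * ‖u σ - u (σ ∘ Equiv.swap x y)‖ ^ 2)
        - 2 * (-(1 / 4 : ℝ) * (ψ σ * ψ (σ ∘ Equiv.swap x y)) *
          (I * A * ((-1 : ℝ) : ℂ) * conj (u σ - u (σ ∘ Equiv.swap x y))).re)
        + (1 / 2 : ℝ) * ‖A‖ ^ 2 * ((1 / 2 : ℝ) * (ψ σ * ψ (σ ∘ Equiv.swap x y)))
        = (ψ σ * ψ (σ ∘ Equiv.swap x y)) *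
          ((1 / 4 : ℝ) * ‖u σ - u (σ ∘ Equiv.swap x y)‖ ^ 2
            + (1 / 2 : ℝ) * (I * A * ((-1 : ℝ) : ℂ) * conj (u σ - u (σ ∘ Equiv.swap x y))).re
            + (1 / 4 : ℝ) * ‖A‖ ^ 2) := by ring
    rw [key]
    exact mul_nonneg hw hsq
  · simp [hx, hy]

end Summit.HubbardSuperconductivity.HubbardSuperconductivity.Theorems.AnisotropyChord.Stiffness
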